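import Summits.Langlands.Langlands.Theses.StickelbergerDial

/-!
# Route StickelbergerDial — `SectorComplement` (stmt-Langlands-17964): logical position

`Summit.Langlands.Langlands.Theses.StickelbergerDial.SectorComplement : Prop :=
WeightZeroNonOrdinaryPA → _root_.Langlands` is the route's declared JUNCTION (rank 9): the third
hypothesis of the deciding theorem
`Theses.StickelbergerDial.closes : UnramifiedFermatWitness → FLLiftingWeightZero →
SectorComplement → Langlands`, filed only so that `closes` ends in the summit constant BY NAME
(route file: "Not this route's business; … same pattern as `AnalyticDescent.SectorComplement`,
`EisensteinGelfandKirillov.SectorComplement`, `WachComponentCensus.SliceToLanglands`;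
difficulty: open-problem").

This file is the kernel record of the item's logical position, written by the crux's line lead
(prover-line-stmt-Langlands-17964-0, 2026-08-17) next to the verdict that no eligible skeleton line
exists for it (`Cruxes/SectorComplement/Lines/Sketch.dead.md`, `Cruxes/SectorComplement/PICKED.md`).
Nothing here asserts the item, the target `WeightZeroNonOrdinaryPA` (X, stmt-Langlands-18031) or
the summit; only modus ponens and the route's sorry-free `closes` are used, so every statement is
agnostic to the exact shape of `_root_.Langlands`.  Seven theorems:

* `stickelbergerDial_sectorComplement_of_langlands`: `Langlands → C` (discard X);
* `stickelbergerDial_sectorComplement_iff_not_or`: truth table `C ↔ ¬ X ∨ Langlands`;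
* `stickelbergerDial_not_sectorComplement_iff`: `¬ C ↔ X ∧ ¬ Langlands` — a disproof of the
  junction is a proof of the open target TOGETHER WITH a refutation of the audited summit;
* `stickelbergerDial_sectorComplement_iff_of_target`: under X, `C ↔ Langlands`;
* `stickelbergerDial_weightZeroNonOrdinaryPA_of_cruxes`: the inner step of `closes`, isolated as a
  glue edge — the door `UnramifiedFermatWitness` (stmt-Langlands-18025) and the engine
  `FLLiftingWeightZero` (stmt-Langlands-18016, = ACC+ 2023 Thm 6.1.1 at weight 0 written out) give
  the target X;
* `stickelbergerDial_sectorComplement_iff_of_cruxes`: under door + engine, `C ↔ Langlands` — once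
  the route's own cruxes land, this item IS the summit;
* `stickelbergerDial_sectorComplement_reciprocityDebt`: what the junction carries, made explicit —
  junction + target deliver, for EVERY number field `F`, reciprocity data (a local Langlands datum
  for `GL_m(F_v)` at every finite place) and BOTH directions of `GL_m` reciprocity for every
  `m ≥ 1`, i.e. the whole summit outside nothing: X (potential automorphy over an extension `K'/K`,
  HLTT-normalised, weight 0) is not a conjunct of the summit as typed, so unlike the
  `EisensteinGelfandKirillov` frame no identity `Langlands ↔ X ∧ C` is available here.

References: the route file `Theses/StickelbergerDial.lean` (items 18031, 18025, 18016, 17964,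
17965); refuter W.lean (rattack-stmt-Langlands-17964, 2026-08-17) for the same truth table checked
at birth; `Theorems/EisensteinGelfandKirillovSectorComplement.lean` and
`Theorems/SkinnerWilesDefectOneSectorComplement.lean` for the sibling frames.
-/

set_option linter.dupNamespace false -- project-wide option; `Summit.Langlands.Langlands` is the mandated namespace

namespace Summit.Langlands.Langlands.Theorems

open Summit.Langlands.Langlands.Theses.StickelbergerDial

/-- The summit implies the junction (discard the sector hypothesis X). [folklore] -/
theorem stickelbergerDial_sectorComplement_of_langlands (hL : _root_.Langlands) :
    SectorComplement :=
  fun _ ↦ hL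

/-- Truth table of the junction: `C ↔ ¬ X ∨ Langlands`. [folklore] -/
theorem stickelbergerDial_sectorComplement_iff_not_or :
    SectorComplement ↔ ¬ WeightZeroNonOrdinaryPA ∨ _root_.Langlands :=
  imp_iff_not_or

/-- EXACT CONTENT OF A DISPROOF of the junction: `¬ C ↔ X ∧ ¬ Langlands` — prove the open target
(non-ordinary weight-zero potential automorphy over CM fields) AND refute the audited summit.
[folklore] -/
theorem stickelbergerDial_not_sectorComplement_iff :
    ¬ SectorComplement ↔ WeightZeroNonOrdinaryPA ∧ ¬ _root_.Langlands :=
  Classical.not_imp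

/-- Under the route TARGET `WeightZeroNonOrdinaryPA`, the junction is literally the summit:
`SectorComplement ↔ Langlands`. [folklore] -/
theorem stickelbergerDial_sectorComplement_iff_of_target (hX : WeightZeroNonOrdinaryPA) :
    SectorComplement ↔ _root_.Langlands :=
  ⟨fun hC ↦ hC hX, fun h _ ↦ h⟩

/-- The inner step of the route's deciding theorem `closes`, isolated as a glue edge: the door
`UnramifiedFermatWitness` hands, over the CM extension `K'`, exactly the hypotheses of the engine
`FLLiftingWeightZero` (ACC+ 2023 Thm 6.1.1 at weight zero, written out) for `r|Γ_{K'}`; the engine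
returns the weight-zero cuspidal `Π`, HLTT-compatible with `r|Γ_{K'}` and unramified above `ℓ` —
which is the conclusion of the target `WeightZeroNonOrdinaryPA`. (Same term as the body of
`closes` after `refine hJ ?_`; restated with the target as conclusion so that nothing is asserted
unconditionally.) [folklore] -/
theorem stickelbergerDial_weightZeroNonOrdinaryPA_of_cruxes (hW : UnramifiedFermatWitness)
    (hF : FLLiftingWeightZero) : WeightZeroNonOrdinaryPA := by
  intro K _ _ hK Kav _ _ hKav n hn ℓ _ hn2 h2n hunr ι r τ h1 h2 hres habs hdg habs' hen hσ
  obtain ⟨K', iF, iN, iA, hgal, hcm, hdisj, hunr', hrest⟩ :=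
    hW K hK Kav hKav n hn ℓ hn2 h2n hunr ι r τ h1 h2 hres habs hdg habs' hen hσ
  obtain ⟨hcpt', τ', π, r₀, h1', h2', hres', habsK, hdgK, habsK', henK, hσK, hwt, hcomp, hres₀,
    hunrπ⟩ := hrest
  obtain ⟨Pi, hPiwt, hPicomp, hPiunr, -⟩ :=
    hF K' (Or.inr hcm) n hcpt' ℓ hn2 h2n hunr' ι (r.restrictField K') τ' π r₀ h1' h2' hres' habsK
      hdgK habsK' henK hσK hwt hcomp hres₀ hunrπ
  exact ⟨K', iF, iN, iA, hgal, hcm, hdisj, hunr', hcpt', Pi, hPiwt, hPicomp, hPiunr⟩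

/-- Under the route's other two cruxes — the door `UnramifiedFermatWitness` and the engine
`FLLiftingWeightZero` — the junction is equivalent to the summit: `SectorComplement ↔ Langlands`
(`→` is the route's sorry-free `closes`). So this item can close only together with the summit
once the route's own cruxes land. [folklore] -/
theorem stickelbergerDial_sectorComplement_iff_of_cruxes (hW : UnramifiedFermatWitness)
    (hF : FLLiftingWeightZero) : SectorComplement ↔ _root_.Langlands :=
  ⟨fun hC ↦ closes hW hF hC, fun h _ ↦ h⟩

/-- **What the junction carries, made explicit**: junction + target deliver, for every number field
`F`, reciprocity data for `F` (in particular a local Langlands datum for `GL_m(F_v)` at every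
finite place `v`) and both directions (A), (B) of `GL_m` reciprocity relative to every `𝓡` and
every `m ≥ 1` — far outside the weight-zero CM potential-automorphy cell of X. [folklore] -/
theorem stickelbergerDial_sectorComplement_reciprocityDebt (hC : SectorComplement)
    (hX : WeightZeroNonOrdinaryPA) (F : Type) [Field F] [NumberField F] :
    Nonempty (Summit.Langlands.ReciprocityData F) ∧
      ∀ (𝓡 : Summit.Langlands.ReciprocityData F) (m : ℕ), 0 < m →
        ∀ hcpt : Literature.NumberTheory.Automorphic.isCompact_glFiniteIntegralLevel m F,
          Summit.Langlands.AutomorphicToGalois m 𝓡 hcpt ∧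
            Summit.Langlands.GaloisToAutomorphic m 𝓡 hcpt :=
  hC hX F

end Summit.Langlands.Langlands.Theorems
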